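import Literature.AnabelianGeometry.EtaleTheta.MuTwoSettingCLevel
import Literature.AnabelianGeometry.EtaleTheta.SettingModelMuTwo
import HarnessLib

/-!
# [EtTh] §1 Def. 1.7 / §2: the C-level parameter record `MuTwoSetting.CLevelData` is INHABITED at the
# §1 model (non-vacuity witness; proof-only)

Mochizuki, *The étale theta function and its Frobenioid-theoretic manifestations*, Publ. RIMS **45**
(2009), §1 Def. 1.7, PRIMS PDF p. 27 ("the stack-theoretic quotient of `X^log` by the natural action of
`±1` … `X^log → C^log` … `Π^tp_C`") and §2 p. 36 ("`1 → Δ_X → Π_X → G_K → 1`, `Δ_C := Ker(Π_C ↠ G_K)`,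
`Gal(X/C) ≅ ℤ/2ℤ`") [cite: MochizukiEtTh2009, Def 1.7 p.27].

Cell abc-iut, layer L2, NON-VACUITY row «NV-L2/CLevelData@model» (seat abc-iut-w5-d221, gen 3).
abc-iut-L2-d3's parameter record `MuTwoSetting.CLevelData M` (`MuTwoSettingCLevel.lean`: the inclusion
`Π^tp_X ↪ Π^tp_C` is an OPEN EMBEDDING, and `Π^tp_C` carries an augmentation `augC : Π^tp_C → G_{ℚ_p}`
extending `aug` with image `G_K`) is consumed as a hypothesis binder `(e : M.CLevelData)` by that file's own
theorems (`conjX`, `exists_geometric_not_mem_range`, `map_inclX_GtpY_normal`), by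
`Discharge/Sec2PiCAugmentation.lean`, `Discharge/Sec2PiTpCResiduallyFinite.lean` and by layer L6's
`PlusMinusTowerCoverModel*` files; it had NO producer in the tree.  THIS FILE (proof-only: no `def`, no
`instance`, no `structure`, no `Prop`-valued fact; the witness is built inside the theorem term) shows that
the record is inhabited at abc-iut-L2-t1's explicit §1 model `MuTwoSetting.model p`
(`SettingModelMuTwo.lean`: `Π^tp_C := Π^tp_X × ℤ/2` with the DISCRETE topology, `inclX` = the first
factor):

* `MuTwoSetting.CLevelData.nonempty_model` — `Nonempty ((MuTwoSetting.model p).CLevelData)`: `inclX`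
  is an open embedding (an injective map between discrete spaces); `augC := aug ∘ pr₁` is continuous,
  extends `aug`, and has image `aug(Π^tp_X) = G_K` (`TemperedCurve.range_aug`);
* `MuTwoSetting.CLevelData.exists_model` — the same with the two data fields exposed
  (`augC (x, t) = aug x`).

HONEST LABEL: a DEGENERATE-class witness (the product model `Π^tp_X × ℤ/2` of abc-iut-L2-t1's
consistency lane, not the tempered fundamental group of an actual orbicurve `C`): it certifies only that
every theorem quantified over `(e : M.CLevelData)` has an inhabited domain at the model — consistency
evidence, not an endorsement.  [EtTh] is a refereed, undisputed paper; nothing of it is asserted here; no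
side is taken on [IUTchIII] Cor. 3.12; instantiated ≠ endorsed.
-/

noncomputable section

namespace Literature.AnabelianGeometry.EtaleTheta

open Literature.AnabelianGeometry.SemiGraphs
open _root_.Topology

namespace MuTwoSetting.CLevelData

variable (p : ℕ) [Fact p.Prime]

/-- **`CLevelData` at the §1 model, with its data exposed**: there is a C-level datum
`e : (MuTwoSetting.model p).CLevelData` whose augmentation is `augC (x, t) = aug x` on
`Π^tp_C = Π^tp_X × ℤ/2` (so `Δ_C = Δ_X × ℤ/2`, "`Gal(X/C) ≅ ℤ/2ℤ`", §2 p. 36).  degenerate: product model.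
[cite: MochizukiEtTh2009, Def 1.7 p.27] -/
theorem exists_model :
    ∃ e : (MuTwoSetting.model p).CLevelData,
      ∀ g : (MuTwoSetting.model p).GtpC, e.augC g = (MuTwoSetting.model p).aug g.1 := by
  -- the augmentation `aug ∘ pr₁ : Π^tp_X × ℤ/2 → G_{ℚ_p}` (continuous: the model group is discrete)
  let A : (MuTwoSetting.model p).GtpC →ₜ* GQp p :=
    { toMonoidHom := (MuTwoSetting.model p).aug.toMonoidHom.comp
        (MonoidHom.fst (SettingModel.PiTp p) (Multiplicative (ZMod 2)))
      continuous_toFun := continuous_of_discreteTopology }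
  have hA : ∀ g : (MuTwoSetting.model p).GtpC, A g = (MuTwoSetting.model p).aug g.1 := fun _ => rfl
  refine ⟨{ isOpenEmbedding_inclX := ?_
            augC := A
            augC_inclX := fun g => hA _
            range_augC := ?_ }, hA⟩
  · -- an injective map between discrete spaces is an open embedding
    exact IsOpenEmbedding.of_continuous_injective_isOpenMap continuous_of_discreteTopology
      (MuTwoSetting.model p).injective_inclX (fun s _ => isOpen_discrete _)
  · -- `(aug ∘ pr₁)(Π^tp_X × ℤ/2) = aug(Π^tp_X) = G_K`
    ext σ
    constructor
    · rintro ⟨g, rfl⟩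
      change A g ∈ (MuTwoSetting.model p).GK
      rw [hA, TemperedCurve.GK, ← (MuTwoSetting.model p).range_aug]
      exact ⟨g.1, rfl⟩
    · intro hσ
      rw [TemperedCurve.GK, ← (MuTwoSetting.model p).range_aug] at hσ
      obtain ⟨x, hx⟩ := hσ
      refine ⟨(MuTwoSetting.model p).inclX x, ?_⟩
      change A ((MuTwoSetting.model p).inclX x) = σ
      rw [hA]
      exact hx

/-- **NV-L2/CLevelData@model**: abc-iut-L2-d3's C-level parameter record is INHABITED at the §1 model —
`Nonempty ((MuTwoSetting.model p).CLevelData)`.  degenerate: product model `Π^tp_C = Π^tp_X × ℤ/2`;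
consistency evidence for every `(e : M.CLevelData)`-quantified theorem, nothing more.
[cite: MochizukiEtTh2009, Def 1.7 p.27] -/
theorem nonempty_model : Nonempty ((MuTwoSetting.model p).CLevelData) :=
  let ⟨e, _⟩ := exists_model p
  ⟨e⟩

end MuTwoSetting.CLevelData

end Literature.AnabelianGeometry.EtaleTheta

end

-- re-land (comment-only, olean-enqueue self-remedy of record 2026-08-26): decls byte-identical to p427235.
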